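import Literature.ModelTheory.ExponentialFields.DefinablyCompactBoxes
import HarnessLib

/-!
# Continuous definable images of closed bounded definable sets are closed and bounded

Topic `Literature/ModelTheory/ExponentialFields`.  Fornasiero–Servi, *Definably complete Baire
structures*, Fund. Math. 209 (2010), Lemma 1.16 (Miller): "Let `f : Kⁿ → Kᵐ` be a definable
continuous function and let `C ⊂ Kⁿ` be definably compact.  Then `f(C)` is definably compact" —
used "often without further comment" in the definable analysis of definably complete fields.
With definable compactness of closed boxes in all dimensions (`DefinablyCompactBoxes.lean`,
`IsDefinablyComplete.exists_forall_mem_of_antitone_pi`) the proof is the compactness argument: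
for `y ∈ cl f(C)` the sets `C ∩ f⁻¹[y - ε, y + ε]ᵐ`, `ε ↓ 0`, form a decreasing definable family
of closed non-empty subsets of `C`, and a common point `x` has `f(x) = y`.

* **`IsDefinablyComplete.isClosed_image_of_continuousOn_pi`** — `f(C)` is closed;
* **`IsDefinablyComplete.image_subset_box_of_continuousOn_pi`** — `f(C)` is bounded (lies in a
  closed box), by the extreme value theorem of `DefinablyCompactBoxes.lean` coordinatewise.

Everything is proved; no definitions.  Conventions (`hlt`, `hadd`; `f` a `DefinableMap`) as in
`DefinablyCompactBoxes.lean`.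

## References

* A. Fornasiero, T. Servi, *Definably complete Baire structures*, Fund. Math. 209 (2010),
  Lemma 1.16. [FornasieroServi2010]
* C. Miller, *Expansions of dense linear orders with the intermediate value property*,
  J. Symbolic Logic 66 (2001). [Miller2001]
-/

open Set FirstOrder FirstOrder.Language
open _root_.Filter _root_.Topology

namespace Literature.ModelTheory.ExponentialFields

universe u v

variable {K : Type*} [Field K] [LinearOrder K] [IsStrictOrderedRing K] [TopologicalSpace K]
  [OrderTopology K] {L : FirstOrder.Language.{u, v}} [L.Structure K]

/-- **The continuous definable image of a closed bounded definable set is closed**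
(Fornasiero–Servi 2010, Lemma 1.16 (Miller), closedness): in a definably complete ordered field
with `<`, `+` definable, if `C ⊆ Kⁿ` is definable, closed and bounded and `f : Kⁿ → Kᵐ` is a
definable map continuous on `C`, then `f(C)` is closed.  (For `y` in the closure, the sets
`C ∩ f⁻¹(Π [yⱼ + s, yⱼ - s])`, `s < 0`, form a decreasing definable family of closed non-empty
subsets of `C`; a common point `x`, by `exists_forall_mem_of_antitone_pi`, has `f x = y`.)
[cite: FornasieroServi2010, Lemma 1.16] -/
theorem _root_.FirstOrder.Language.IsDefinablyComplete.isClosed_image_of_continuousOn_pi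
    (hDC : L.IsDefinablyComplete K)
    (hlt : (univ : Set K).Definable L {v : Fin 2 → K | v 0 < v 1})
    (hadd : (univ : Set K).Definable L {v : Fin 3 → K | v 2 = v 0 + v 1})
    {n m : ℕ} {C : Set (Fin n → K)} (hC : (univ : Set K).Definable L C) (hCcl : IsClosed C)
    {a b : K} (hCsub : ∀ x ∈ C, ∀ i, a ≤ x i ∧ x i ≤ b)
    {f : (Fin n → K) → (Fin m → K)} (hf : (univ : Set K).DefinableMap L f)
    (hcont : ContinuousOn f C) : IsClosed (f '' C) := by
  refine closure_subset_iff_isClosed.1 fun y hy => ?_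
  -- the family `Y s = C ∩ {x | ∀ j, y j + s ≤ f x j ≤ y j - s}`, `s < 0`
  set Y : K → Set (Fin n → K) :=
    fun s => C ∩ {x | ∀ j, y j + s ≤ f x j ∧ f x j ≤ y j + -s} with hY
  set N : Set K := Iio 0 with hN
  have hNdef : (univ : Set K).Definable₁ L N := by
    have h : (univ : Set K).Definable L {v : Fin 1 → K | v 0 < 0} :=
      definable_setOf_lt_params hlt (definableFun_proj_params 0)
        (definableFun_const_params _ (mem_univ _))
    simpa [Set.Definable₁, hN] using h
  have hNne : N.Nonempty := exists_lt (0 : K)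
  -- definability of the family
  have hid : (univ : Set K).Definable L {v : Fin 2 → K | v 1 = (fun s => s) (v 0)} :=
    definable_setOf_eq_params (definableFun_proj_params 1) (definableFun_proj_params 0)
  have hneg : (univ : Set K).Definable L {v : Fin 2 → K | v 1 = (fun s => -s) (v 0)} :=
    definable_graph_neg hadd (f := fun s => s) hid
  have hYdef : (univ : Set K).Definable L {v : Fin (n + 1) → K | Fin.tail v ∈ Y (v 0)} := by
    have hfj : ∀ j : Fin m, (univ : Set K).DefinableFun L (fun v : Fin (n + 1) → K => f (Fin.tail v) j) :=
      fun j => (hf j).comp definableMap_tail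
    have hlow : ∀ j : Fin m, (univ : Set K).DefinableFun L (fun v : Fin (n + 1) → K => y j + v 0) :=
      fun j => definableFun_apply₂_params hadd (definableFun_const_params _ (mem_univ (y j)))
        (definableFun_proj_params 0)
    have hup : ∀ j : Fin m, (univ : Set K).DefinableFun L (fun v : Fin (n + 1) → K => y j + -v 0) :=
      fun j => definableFun_apply₂_params hadd (definableFun_const_params _ (mem_univ (y j)))
        (definableFun_apply_params (f := fun s => -s) hneg (definableFun_proj_params 0))
    have h := (definable_family_const (L := L) (n := n) (S := C) hC).inter
      (definable_iInter_of_finite (L := L) (A := (univ : Set K)) fun j : Fin m =>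
        (definable_setOf_le_params hlt (hlow j) (hfj j)).inter
          (definable_setOf_le_params hlt (hfj j) (hup j)))
    refine (congrArg _ ?_).mpr h
    ext v
    simp [hY]
  have hanti : ∀ s ∈ N, ∀ s' ∈ N, s ≤ s' → Y s' ⊆ Y s := by
    intro s _ s' _ hss' x hx
    refine ⟨hx.1, fun j => ⟨?_, ?_⟩⟩
    · linarith [(hx.2 j).1]
    · linarith [(hx.2 j).2]
  have hcl : ∀ s ∈ N, IsClosed (Y s) := by
    intro s _
    have h : Y s = C ∩ ⋂ j, (C ∩ (fun x => f x j) ⁻¹' Icc (y j + s) (y j + -s)) := by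
      ext x
      simp only [hY, mem_inter_iff, mem_setOf_eq, mem_iInter, mem_preimage, mem_Icc]
      exact ⟨fun ⟨hc, h⟩ => ⟨hc, fun j => ⟨hc, h j⟩⟩, fun ⟨hc, h⟩ => ⟨hc, fun j => (h j).2⟩⟩
    rw [h]
    refine hCcl.inter (isClosed_iInter fun j => ?_)
    exact ((continuous_apply j).comp_continuousOn hcont).preimage_isClosed_of_isClosed hCcl
      isClosed_Icc
  have hne : ∀ s ∈ N, (Y s).Nonempty := by
    intro s hs
    have hs0 : 0 < -s := neg_pos.2 hs
    rw [mem_closure_iff_forall_box] at hy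
    obtain ⟨_, ⟨x, hxC, rfl⟩, hbox⟩ := hy (fun j => y j + s) (fun j => y j + -s) fun j =>
      ⟨by linarith, by linarith⟩
    exact ⟨x, hxC, fun j => ⟨(hbox j).1.le, (hbox j).2.le⟩⟩
  have hsub : ∀ s ∈ N, ∀ x ∈ Y s, ∀ i, a ≤ x i ∧ x i ≤ b := fun s _ x hx => hCsub x hx.1
  obtain ⟨x, hx⟩ := hDC.exists_forall_mem_of_antitone_pi hlt hadd n (N := N) (Y := Y) hNdef hNne
    hYdef hanti hcl hne hsub
  obtain ⟨s₀, hs₀⟩ := hNne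
  have hxC : x ∈ C := (hx s₀ hs₀).1
  refine ⟨x, hxC, ?_⟩
  funext j
  refine eq_of_abs_sub_le_all fun ε hε => ?_
  have h := (hx (-ε) (by simpa [hN] using hε)).2 j
  rw [neg_neg] at h
  rw [abs_sub_le_iff]
  constructor <;> linarith [h.1, h.2]

/-- **The continuous definable image of a closed bounded definable set is bounded**
(Fornasiero–Servi 2010, Lemma 1.16 (Miller), boundedness): each coordinate function attains its
extrema (`DefinablyCompactBoxes.lean`). [cite: FornasieroServi2010, Lemma 1.16] -/
theorem _root_.FirstOrder.Language.IsDefinablyComplete.image_subset_box_of_continuousOn_pi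
    (hDC : L.IsDefinablyComplete K)
    (hlt : (univ : Set K).Definable L {v : Fin 2 → K | v 0 < v 1})
    (hadd : (univ : Set K).Definable L {v : Fin 3 → K | v 2 = v 0 + v 1})
    {n m : ℕ} {C : Set (Fin n → K)} (hC : (univ : Set K).Definable L C) (hCcl : IsClosed C)
    {a b : K} (hCsub : ∀ x ∈ C, ∀ i, a ≤ x i ∧ x i ≤ b)
    {f : (Fin n → K) → (Fin m → K)} (hf : (univ : Set K).DefinableMap L f)
    (hcont : ContinuousOn f C) :
    ∃ a' b' : K, ∀ z ∈ f '' C, ∀ j, a' ≤ z j ∧ z j ≤ b' := by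
  classical
  rcases C.eq_empty_or_nonempty with rfl | hCne
  · exact ⟨0, 0, by simp⟩
  -- coordinatewise maxima and minima
  have hmax : ∀ j : Fin m, ∃ x ∈ C, ∀ x' ∈ C, f x' j ≤ f x j := fun j =>
    hDC.exists_forall_le_of_continuousOn_pi hlt hadd hC hCcl hCne hCsub (hf j)
      ((continuous_apply j).comp_continuousOn hcont)
  have hmin : ∀ j : Fin m, ∃ x ∈ C, ∀ x' ∈ C, f x j ≤ f x' j := fun j =>
    hDC.exists_forall_ge_of_continuousOn_pi hlt hadd hC hCcl hCne hCsub (hf j)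
      ((continuous_apply j).comp_continuousOn hcont)
  choose xM hxM hM using hmax
  choose xm hxm hm using hmin
  rcases isEmpty_or_nonempty (Fin m) with hm0 | hm0
  · exact ⟨0, 0, fun z _ j => (hm0.false j).elim⟩
  refine ⟨Finset.univ.inf' Finset.univ_nonempty fun j => f (xm j) j,
    Finset.univ.sup' Finset.univ_nonempty fun j => f (xM j) j, ?_⟩
  rintro _ ⟨x, hx, rfl⟩ j
  constructor
  · exact (Finset.inf'_le _ (Finset.mem_univ j)).trans (hm j x hx)
  · exact (hM j x hx).trans (Finset.le_sup' (fun j => f (xM j) j) (Finset.mem_univ j))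

end Literature.ModelTheory.ExponentialFields
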